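import Summits.CriticalPhenomena.PercolationContinuityZ3.Theorems.PercNearOneGluingNoHeavyLowerTailSunflowerForcedReduction
import HarnessLib
import HarnessLib.Audit

/-!
# `NoHeavyLowerTail` (crux stmt-CriticalPhenomena-4575), abstract sunflower cubic: the three-up-set inequality (R2) implies the
# partition lemma for EVERY finite sunflower — `PartitionLemmaH ⟺ ThreeUpsetPartitionIneq` unconditionally

Support file (seat `prim-l12-p2` gen 11; `--supports stmt-CriticalPhenomena-4575`).  Nothing is asserted about the crux; no `sorry`, no named
facts; `PartitionLemmaH` and `ThreeUpsetPartitionIneq` (prove-1 gen 25, `@[conjecture]`) are used only as explicit hypotheses.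

prove-1 gen 25 (`…SunflowerForcedReduction`) proved `ThreeUpsetPartitionIneq → PartitionLemmaHFounded`: (R2) gives the partition lemma for
PETAL-FOUNDED sunflowers (every kernel set contains a petal set), by demoting unforced kernel sets and promoting them back
(`ZH_le_ZH_promote`).  The restriction is unnecessary: an UNFOUNDED kernel set `K` of minimal cardinality (no petal set and hence — by
minimality — no kernel set strictly below it) can itself be demoted to a petal (`Sunflower.demote`, legal precisely by minimality); promoting it back
recovers `F` and `ZH` can only grow (`ZH_le_ZH_promote`), while the demoted sunflower has strictly fewer unfounded kernel sets (its petal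
families only grow).  Induction on the number of unfounded kernel sets reaches a petal-founded sunflower, where prove-1's theorem applies.
(The degenerate case `∅ ∈ A` — everything is kernel — has `ZH = 0`.)

* `Sunflower.ZH_nonneg_of_threeUpset_aux` — the induction on the number of unfounded kernel sets (kernel sets containing no petal set);
* **`partitionLemmaH_of_threeUpset : ThreeUpsetPartitionIneq → PartitionLemmaH`**, and with prove-1's converse
  `threeUpset_of_partitionLemmaH` the equivalence **`partitionLemmaH_iff_threeUpset`**: the partition lemma ★_H for monotone maps `2^α → M₃` is
  EXACTLY the counting inequality (R2) about three arbitrary up-sets `U₁,U₂,U₃ ⊆ 2^α` (θ-pullback: kernel = "in ≥ 2 of the U_i", petal `i` = "in U_i only").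
Memo: run/shared/lean/prim/prim-l12/prim-l12-p2/FINDING-g11-RS-DOMINANCE.md §D.
-/

namespace Summit.CriticalPhenomena.PercolationContinuityZ3.Theorems.SunflowerPartition

open Finset

variable {α : Type*} [Fintype α] [DecidableEq α]

namespace Sunflower

variable (F : Sunflower α)

omit [Fintype α] in
/-- A sunflower with no unfounded kernel set is petal-founded. [this work] -/
theorem founded_of_unfounded_eq_empty (h : ((F.A).filter fun S => ¬ ∃ i : Fin 3, ∃ P ∈ F.petal i, P ⊆ S) = ∅) :
    ∀ S ∈ F.A, ∃ i : Fin 3, ∃ P ∈ F.petal i, P ⊆ S := by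
  intro S hS
  by_contra hc
  have : S ∈ ((F.A).filter fun S => ¬ ∃ i : Fin 3, ∃ P ∈ F.petal i, P ⊆ S) := mem_filter.2 ⟨hS, hc⟩
  rw [h] at this
  simp at this

/-- If the empty set is a kernel set then every label is top and `ZH = 0`. [this work] -/
theorem ZH_eq_zero_of_empty_mem_A (h : ∅ ∈ F.A) : F.ZH = 0 := by
  have hall : ∀ S : Finset α, F.lab S = 4 := by
    intro S
    have hS : S ∈ F.A := F.mem_A_of_subset (empty_subset S) h
    simp [lab, hS]
  unfold ZH
  refine sum_eq_zero fun q _ => ?_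
  rw [hall, hall, hall]
  decide

end Sunflower

/-- **Induction**: (R2) for the relevant petal closures gives `0 ≤ ZH F` for every sunflower with at most `n` unfounded kernel sets. [this work] -/
theorem Sunflower.ZH_nonneg_of_threeUpset_aux {α : Type} [Fintype α] [DecidableEq α] (h3 : ThreeUpsetPartitionIneq) :
    ∀ (n : ℕ) (F : Sunflower α), #((F.A).filter fun S => ¬ ∃ i : Fin 3, ∃ P ∈ F.petal i, P ⊆ S) ≤ n → 0 ≤ F.ZH := by
  intro n
  induction n with
  | zero =>
    intro F hn
    have h0 : ((F.A).filter fun S => ¬ ∃ i : Fin 3, ∃ P ∈ F.petal i, P ⊆ S) = ∅ := card_eq_zero.1 (Nat.le_zero.1 hn)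
    exact partitionLemmaHFounded_of_threeUpset h3 α F (F.founded_of_unfounded_eq_empty h0)
  | succ n ih =>
    intro F hn
    set UF := ((F.A).filter fun S => ¬ ∃ i : Fin 3, ∃ P ∈ F.petal i, P ⊆ S) with hUF
    by_cases hne : UF.Nonempty
    swap
    · rw [not_nonempty_iff_eq_empty] at hne
      exact partitionLemmaHFounded_of_threeUpset h3 α F (F.founded_of_unfounded_eq_empty hne)
    -- an unfounded kernel set of minimal cardinality
    obtain ⟨K, hKmem, hKmin⟩ := exists_min_image UF (fun S => #S) hne
    have hKA : K ∈ F.A := (mem_filter.1 hKmem).1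
    have hKnf : ¬ ∃ i : Fin 3, ∃ P ∈ F.petal i, P ⊆ K := (mem_filter.1 hKmem).2
    -- degenerate case: K = ∅
    by_cases hK0 : K = ∅
    · subst hK0; exact le_of_eq (F.ZH_eq_zero_of_empty_mem_A hKA).symm
    have hKne : K.Nonempty := nonempty_iff_ne_empty.2 hK0
    -- no member of any `V i` lies strictly below `K`
    have hbelow : ∀ i, ∀ S ∈ F.V i, S ⊆ K → S = K := by
      intro i S hS hSK
      by_contra hSne
      rw [Sunflower.V_eq_A_union_upcl, mem_union] at hS
      rcases hS with hS | hS
      · -- a kernel set strictly below K: founded contradicts hKnf, unfounded contradicts minimality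
        by_cases hSf : ∃ j : Fin 3, ∃ P ∈ F.petal j, P ⊆ S
        · obtain ⟨j, P, hP, hPS⟩ := hSf
          exact hKnf ⟨j, P, hP, hPS.trans hSK⟩
        · have hlt : #S < #K := card_lt_card (lt_of_le_of_ne hSK hSne)
          have := hKmin S (mem_filter.2 ⟨hS, hSf⟩)
          omega
      · -- a member of a petal closure below K makes K founded
        obtain ⟨P, hP, hPS⟩ := Sunflower.mem_upcl.1 hS
        exact hKnf ⟨i, P, hP, hPS.trans hSK⟩
    -- the demotion of K to petal 0 is legal
    have hup : ∀ i, i ≠ (0 : Fin 3) → ∀ S ∈ F.V i, S ≠ K → ∀ T, S ⊆ T → T ≠ K := by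
      intro i _ S hS hSne T hST hTK
      subst hTK
      exact hSne (hbelow i S hS hST)
    set G := F.demote K 0 hup with hG
    have hGA : G.A = (F.A).erase K := F.demote_A K 0 hup
    have hKV : ∀ i, K ∈ F.V i := fun i => F.A_subset_V i hKA
    have hGV : ∀ i (S : Finset α), S ∈ G.V i ↔ S ∈ (if i = 0 then F.V i else (F.V i).erase K) := fun i S => Iff.rfl
    -- K is a petal-0 set of G
    have hGlab : G.lab K = 1 ∨ G.lab K = 2 ∨ G.lab K = 3 := by
      left
      have hKGA : K ∉ G.A := by rw [hGA]; exact Finset.notMem_erase K F.A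
      have hK0V : K ∈ G.V 0 := by rw [hGV]; simp only [if_true]; exact hKV 0
      unfold Sunflower.lab
      rw [if_neg hKGA, if_pos hK0V]
    -- proper supersets of K are kernel in G
    have hsup : ∀ T : Finset α, K ⊂ T → T ∈ G.A := by
      intro T hKT
      rw [hGA, mem_erase]
      exact ⟨(ne_of_lt hKT).symm, F.mem_A_of_subset hKT.le hKA⟩
    -- petal families of G contain those of F
    have hpetal : ∀ i, F.petal i ⊆ G.petal i := by
      intro i P hP
      unfold Sunflower.petal at hP ⊢
      rw [mem_sdiff] at hP ⊢
      have hPK : P ≠ K := fun h => hP.2 (h ▸ hKA)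
      refine ⟨?_, by rw [hGA, mem_erase]; exact fun h => hP.2 h.2⟩
      rw [hGV]
      by_cases hi : i = 0
      · simp only [hi, if_true]; exact hi ▸ hP.1
      · simp only [hi, if_false, mem_erase]; exact ⟨hPK, hP.1⟩
    -- the unfounded kernel sets of G are among those of F, minus K
    have hsubset : ((G.A).filter fun S => ¬ ∃ i : Fin 3, ∃ P ∈ G.petal i, P ⊆ S) ⊆ UF.erase K := by
      intro S hS
      rw [mem_filter, hGA, mem_erase] at hS
      rw [mem_erase, hUF, mem_filter]
      refine ⟨hS.1.1, hS.1.2, fun ⟨i, P, hP, hPS⟩ => hS.2 ⟨i, P, hpetal i hP, hPS⟩⟩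
    have hcard : #((G.A).filter fun S => ¬ ∃ i : Fin 3, ∃ P ∈ G.petal i, P ⊆ S) ≤ n := by
      have h1 : #((G.A).filter fun S => ¬ ∃ i : Fin 3, ∃ P ∈ G.petal i, P ⊆ S) ≤ #(UF.erase K) := card_le_card hsubset
      have h2 : #(UF.erase K) = #UF - 1 := card_erase_of_mem hKmem
      have h3 : 0 < #UF := card_pos.2 hne
      omega
    -- conclude
    have ih' := ih G hcard
    have hprom : G.ZH ≤ (G.promote K hsup).ZH := G.ZH_le_ZH_promote K hsup hKne hGlab
    have hback : (G.promote K hsup).ZH = F.ZH := Sunflower.ZH_congr (F.promote_demote_V K 0 hup hKV hsup)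
    calc (0 : ℤ) ≤ G.ZH := ih'
      _ ≤ (G.promote K hsup).ZH := hprom
      _ = F.ZH := hback



/-- **MAIN REDUCTION, unconditional** (this work): the three-up-set inequality (R2) implies the partition lemma ★_H for EVERY finite sunflower
of up-sets (no petal-foundedness needed). [this work] -/
theorem partitionLemmaH_of_threeUpset (h : ThreeUpsetPartitionIneq) : PartitionLemmaH := by
  intro α _ _ F
  exact Sunflower.ZH_nonneg_of_threeUpset_aux h _ F le_rfl

/-- **★_H ⟺ (R2)**: the partition lemma for monotone maps `2^α → M₃` is equivalent to the three-up-set counting inequality. [this work] -/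
theorem partitionLemmaH_iff_threeUpset : PartitionLemmaH ↔ ThreeUpsetPartitionIneq :=
  ⟨threeUpset_of_partitionLemmaH, partitionLemmaH_of_threeUpset⟩

end Summit.CriticalPhenomena.PercolationContinuityZ3.Theorems.SunflowerPartition
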